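import Summits.Ventures.PercRepro.C041BlockMapEar

/-!
# ROW C-041 — THEOREMS (PATH), (BUNDLE) AND (EAR) ON THE ATTACHMENT: the six-vectors of multi-exit attachments
whose host has an edge replaced by a path, by a bundle or by an ear (p6, gen 35; the zone-level forms of
`C041BlockMapPath`, `C041BlockMapBundle` and `C041BlockMapEar` through THEOREM (BLOCK MAP, `r` EXITS))

Setting of `C041MultiExitMain`: the attachment `hang Z₁ u Z a` of the zones `Z k` at the exits `u k` of the
unmarked host `Z₁`, whose six-vector at the anchor is the block map of the host at the six-vectors of the zones
(`sixVec_hang_eq_blockMap`).  Replacing an edge `e₀` of the host by a path with `n` internal vertices adds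
`2ⁿ − 1` times the attachment on the loopified host (`sixVec_hang_path`), replacing it by a bundle of `m + 1`
parallel copies adds `2ᵐ − 1` times the attachment on the contracted host (`sixVec_hang_bundle`), and adding an
ear of length `n + 1` between `x` and `y` adds `2^{n+1} − 2` times the attachment on the host to the attachment
on the host with the chord (`sixVec_hang_ear`) — exact identities of six-vectors of zones, for every family of
zones.
-/

namespace PercRepro

namespace ZoneZ

namespace MultiExit

open ZoneData Pendant Finset TwoExit TreeClosure

variable {ι V₁ E₁ U₁ U₂ : Type} {V E T₁ T₂ : ι → Type}
variable (Z₁ : ZoneData V₁ E₁ U₁ U₂) (u : ι → V₁) (Z : (k : ι) → ZoneData (V k) (E k) (T₁ k) (T₂ k))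
  (a : (k : ι) → V k) (a₁ : V₁)
variable [Fintype ι] [DecidableEq ι] [∀ k, Fintype (E k)] [∀ k, DecidableEq (E k)] [∀ k, Fintype (T₁ k)]
  [∀ k, DecidableEq (T₁ k)] [∀ k, Fintype (T₂ k)] [∀ k, DecidableEq (T₂ k)] [Fintype E₁] [DecidableEq E₁]

/-- **THEOREM (PATH) on the attachment**: replacing the edge `e₀` of the host by a path with `n` internal vertices
adds `2ⁿ − 1` times the attachment on the loopified host. -/
theorem sixVec_hang_path (e₀ : E₁) (n : ℕ) :
    (hang (pathHost Z₁ e₀ n) (fun k => Sum.inl (u k)) Z a).sixVec (Sum.inl (Sum.inl a₁)) =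
      (hang Z₁ u Z a).sixVec (Sum.inl a₁) +
        ((2 : ℝ) ^ n - 1) • (hang (loopify Z₁ e₀) u Z a).sixVec (Sum.inl a₁) := by
  rw [sixVec_hang_eq_blockMap, sixVec_hang_eq_blockMap, sixVec_hang_eq_blockMap, blockMap_path]

/-- **THEOREM (PATH) on the attachment, deletion form**: the path adds `2^{n+1} − 2` times the attachment on the
host with `e₀` deleted. -/
theorem sixVec_hang_path_del (e₀ : E₁) (n : ℕ) :
    (hang (pathHost Z₁ e₀ n) (fun k => Sum.inl (u k)) Z a).sixVec (Sum.inl (Sum.inl a₁)) =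
      (hang Z₁ u Z a).sixVec (Sum.inl a₁) +
        ((2 : ℝ) ^ (n + 1) - 2) • (hang (del Z₁ e₀) u Z a).sixVec (Sum.inl a₁) := by
  rw [sixVec_hang_eq_blockMap, sixVec_hang_eq_blockMap, sixVec_hang_eq_blockMap, blockMap_path_del]

/-- **THEOREM (BUNDLE) on the attachment**: replacing the edge `e₀` of the host by a bundle of `m + 1` parallel
copies adds `2ᵐ − 1` times the attachment on the contracted host (exits and anchor redirected). -/
theorem sixVec_hang_bundle [DecidableEq V₁] (e₀ : E₁) (m : ℕ) :
    (hang (bundle Z₁ e₀ m) u Z a).sixVec (Sum.inl a₁) =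
      (hang Z₁ u Z a).sixVec (Sum.inl a₁) + ((2 : ℝ) ^ m - 1) •
        (hang (contract Z₁ (Z₁.fst e₀) (Z₁.snd e₀)) (fun k => redC (Z₁.fst e₀) (Z₁.snd e₀) (u k)) Z a).sixVec
          (Sum.inl (redC (Z₁.fst e₀) (Z₁.snd e₀) a₁)) := by
  rw [sixVec_hang_eq_blockMap, sixVec_hang_eq_blockMap, sixVec_hang_eq_blockMap, blockMap_bundle]

/-- **THEOREM (EAR) on the attachment**: adding an ear of length `n + 1` between `x` and `y` gives the attachment
on the host with the chord plus `2^{n+1} − 2` times the attachment on the host. -/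
theorem sixVec_hang_ear (x y : V₁) (n : ℕ) :
    (hang (ear Z₁ x y n) (fun k => Sum.inl (u k)) Z a).sixVec (Sum.inl (Sum.inl a₁)) =
      (hang (addEdge Z₁ x y) u Z a).sixVec (Sum.inl a₁) +
        ((2 : ℝ) ^ (n + 1) - 2) • (hang Z₁ u Z a).sixVec (Sum.inl a₁) := by
  rw [sixVec_hang_eq_blockMap, sixVec_hang_eq_blockMap, sixVec_hang_eq_blockMap, blockMap_ear]

end MultiExit

end ZoneZ

end PercRepro
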